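import Summits.BirchSwinnertonDyer.BirchSwinnertonDyer.Theorems.CyclotomicUntwistTwistedMomentAtLevel
import Literature.NumberTheory.EllipticCurves.AtkinLehnerInvolutionsNewformProofs
import Literature.NumberTheory.EllipticCurves.LFunctionCoefficientBound
import Literature.NumberTheory.EllipticCurves.RohrlichNonvanishingCoeffFieldProofs
import HarnessLib

/-!
# Non-vanishing of the first moment of `L(f ⊗ χ, 1)` over the wild characters of conductor `p^m`
# at a prime `p` DIVIDING the level; the newform of an elliptic curve at ANY prime

Cell `pub/bsd-wall` (D-0145 line `route-BirchSwinnertonDyer-CyclotomicUntwist`), seat `bsd-line-cycu-p5`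
(width seat 5), helper toward crux K1 `PSRankOneLowerHalfAtThree` (stmt-BirchSwinnertonDyer-21580):
step 2 of 3 of making «`𝓛^η_W ≢ 0`» (`CyclotomicUntwistUntwistedNonvanishing.exists_apply_ne_zero_of_rohrlich`,
there modulo a Rohrlich-1989-type hypothesis `hR`) UNCONDITIONAL. THEOREMS ONLY (no definition, no
named fact, no `sorry`); BSD is not proved by this file and no crux is.

The tree's first-moment non-vanishing theorem `exists_wildChars_twistedSymbolSum_ne_zero`
(`PAdicLFunctionMomentProofs`; the replacement of Rohrlich's 1984 theorem behind `L_p(E,T) ≠ 0`)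
needs `p ∤ N` because its two-sided series flips by the Fricke involution. Feeding instead the
Atkin–Lehner two-sided series of the companion `CyclotomicUntwistTwistedMomentAtLevel`
(`sum_wildChars_twistedSymbolSum_eq_atkinLehner`, flip at the prime-to-`p` part `Q ∥ N`, valid for
`m ≥ v_p(N)`) into the SAME asymptotic argument gives:

* `exists_wildChars_twistedSymbolSum_ne_zero_atkinLehner` — for `f ∈ S₂(Γ₀(N))` with `w_Q f = ε f`
  (`Q ∥ N`, `p ∤ Q`, `N ∣ Q p^{m₁}`, `ε² = 1`), `a₁ = 1` and `|aₙ| ≤ C n^θ` for some `θ < 2/3`: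
  **for all large `m` some wild character `χ` of conductor `p^m` (primitive, even, of `p`-power
  order) has `∑_a χ(a){∞, a/p^m}_f ≠ 0`** (i.e. `L(f, χ̄, 1) ≠ 0` by Birch's formula). With
  `Y = p^{-am}`, `3/2 < a < 1/θ`, the weighted moment `∑_{χ ∈ 𝔛_m} (τ(χ)/p^m) ∑_a χ̄(a){∞,a/p^m}`
  is `#𝔛_m e^{-2πY} + O(#𝔛_m δ_m)`, `δ_m → 0`, by `norm_dampedTwist_sum_wildChars_sub_le` (main
  term, level-free) and `norm_dampedTwist_dual_le_of_not_dvd` (dual term, weight `χ(Q)τ(χ)²`,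
  Kloosterman bound); the only change from the `p ∤ N` proof is `N ↦ Q` in the dual term (exponent algebra reused from
  `RohrlichNonvanishingCoeffFieldProofs`: `main_exponent_eq_offset`, `dual_exponent_eq_offset`,
  `pow_ceil_half_le_offset`).
* `exists_wildChars_twistedSymbolSum_ne_zero_of_isNewformOf` — **for the newform `f` of ANY elliptic
  curve `E/ℚ` and ANY prime `p`** (good or bad): `Q = N / p^{v_p(N)}` is an exact divisor with
  `p ∤ Q`, a newform is a `w_Q`-eigenvector with `ε = ±1` (`IsNewform0.exists_atkinLehnerInvolution_eq_smul`,
  Knapp 1993 Thm. 9.27(b), proved in the tree), `a₁ = 1`, and `|aₙ| ≤ 16²⁵⁶ n^{5/8}` (Ramanujan–Hasse,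
  `WeierstrassCurve.norm_LFunction_le_rpow`). This removes the hypothesis `p ∤ N` from the tree's
  engine; at a prime of multiplicative or additive reduction it is the non-vanishing input for
  "the `p`-adic `L`-function (Mazur–Tate–Teitelbaum §I.10 with `ε(p) = 0`, or the untwisted one of
  D1) is not identically zero", replacing Rohrlich, Invent. Math. 97 (1989) (twists ramified at the
  level), which is not in the tree.

References: D. E. Rohrlich, Invent. Math. 75 (1984), §2–§4 [cite: RohrlichInventiones1984, §3];
A. W. Knapp, *Elliptic curves* (1993), Lemma 9.24, Thm. 9.27 [cite: Knapp1993, Thm. 9.27];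
B. Mazur, J. Tate, J. Teitelbaum, Invent. Math. 84 (1986), §I.10, §I.17
[cite: MazurTateTeitelbaum1986Invent, §I.17].
-/

noncomputable section

open scoped MatrixGroups ModularForm BigOperators Real

open CongruenceSubgroup UpperHalfPlane Complex MeasureTheory Set Finset Filter Topology
  Literature.NumberTheory.EllipticCurves Literature.NumberTheory.EllipticCurves.ModularForms
  Summit.BirchSwinnertonDyer.BirchSwinnertonDyer.Theorems.PSTwistedMomentAtLevel

-- single-conjunct summit: `Summit.BirchSwinnertonDyer.BirchSwinnertonDyer.…` repeats the name by design
set_option linter.dupNamespace false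
set_option autoImplicit false

namespace Summit.BirchSwinnertonDyer.BirchSwinnertonDyer.Theorems.PSNonvanishingAtLevel



/-! ### Non-vanishing of the first moment with the Atkin–Lehner flip -/

section Final

variable {N : ℕ} [NeZero N] (f : CuspForm (Gamma0 N) 2) {p : ℕ} [hp : Fact p.Prime]
  {Q : ℕ} [NeZero Q]

/-- **Non-vanishing of the first moment at a prime dividing the level.** Let `f ∈ S_2(Γ₀(N))`
with `w_Q f = ε f` for an exact divisor `Q ∥ N` with `p ∤ Q` and `N ∣ Q p^{m₁}` (`ε² = 1`), with
`a₁(f) = 1` and `|aₙ(f)| ≤ C n^θ` for some `θ < 2/3`. Then for all large `m` some wild character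
`χ` of conductor `p^m` (primitive, even, of `p`-power order) has `∑_a χ(a){∞, a/p^m}_f ≠ 0`, i.e.
`L(f, χ̄, 1) ≠ 0`. Proof: verbatim the asymptotic argument of
`exists_wildChars_twistedSymbolSum_ne_zero` (Rohrlich 1984 §3–§4: `Y = p^{-am}`, `3/2 < a < 1/θ`,
main term `#𝔛_m e^{-2πY}`, errors `O(#𝔛_m δ_m)` with `δ_m → 0`), run on the Atkin–Lehner moment
identity `sum_wildChars_twistedSymbolSum_eq_atkinLehner` (dual form `ε f`, dual level `Q`).
[cite: RohrlichInventiones1984, §3] -/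
theorem exists_wildChars_twistedSymbolSum_ne_zero_atkinLehner (hQN : Q ∣ N)
    (hc : Nat.Coprime Q (N / Q)) {ε : ℂ} (hε : atkinLehnerInvolution N 2 Q f = ε • f)
    (hε1 : ε ^ 2 = 1) (hpQ : ¬ p ∣ Q) {m₁ : ℕ} (hNm₁ : N ∣ Q * p ^ m₁)
    {C θ : ℝ} (hC : 0 ≤ C) (hθ : 0 < θ) (hθ1 : θ < 2 / 3)
    (ha : ∀ n : ℕ, ‖cuspCoeff f n‖ ≤ C * (n : ℝ) ^ θ) (h1 : cuspCoeff f 1 = 1) :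
    ∃ m₀ : ℕ, ∀ m : ℕ, m₀ ≤ m → ∃ χ ∈ wildChars p m, twistedSymbolSum f χ ≠ 0 := by
  have hpr : (1 : ℝ) < p := by exact_mod_cast hp.out.one_lt
  have hp0 : (0 : ℝ) < p := by linarith
  have hQr : (0 : ℝ) < Q := Nat.cast_pos.mpr (NeZero.pos Q)
  have h2π : (0 : ℝ) < 2 * Real.pi := Real.two_pi_pos
  have hεn : ‖ε‖ = 1 := by
    have h : ‖ε‖ ^ 2 = 1 := by rw [← norm_pow, hε1, norm_one]
    exact (pow_eq_one_iff_of_nonneg (norm_nonneg ε) two_ne_zero).mp h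
  -- the dual exponent `θ' = θ ≤ 1`
  have hθ'1 : θ ≤ 1 := by linarith
  -- the exponent `a`, `3/2 < a < 1/θ`
  set a : ℝ := 3 / 4 + 1 / (2 * θ) with hadef
  have haθ' : a * θ = 3 / 4 * θ + 1 / 2 := by
    rw [hadef]; field_simp
  have haθ : a * θ - 1 < 0 := by rw [haθ']; linarith
  have ha32 : 3 / 2 < a := by
    have : 3 / 4 < 1 / (2 * θ) := by
      rw [lt_div_iff₀ (by positivity)]; linarith
    rw [hadef]; linarith
  have ha0 : 0 < a := by linarith
  have hdual : (2 - a) * θ - 1 / 2 < 0 := by nlinarith [mul_pos (sub_pos.mpr ha32) hθ, hθ'1]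
  -- the parameters as functions of `m`
  set X : ℕ → ℝ := fun m ↦ (p : ℝ) ^ m with hXdef
  set q : ℕ → ℝ := fun m ↦ (p : ℝ) ^ (m - 1) with hqdef
  set Y : ℕ → ℝ := fun m ↦ X m ^ (-a) with hYdef
  have hXpos : ∀ m, 0 < X m := fun m ↦ pow_pos hp0 m
  have hqpos : ∀ m, 0 < q m := fun m ↦ pow_pos hp0 _
  have hYpos : ∀ m, 0 < Y m := fun m ↦ Real.rpow_pos_of_pos (hXpos m) _
  have hXq : ∀ m, m ≠ 0 → X m = p * q m := fun m hm ↦ by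
    simp only [hXdef, hqdef]
    rw [← pow_succ', Nat.sub_add_cancel (Nat.pos_of_ne_zero hm)]
  -- the error sequences
  set e₁ : ℝ := (θ - 1) / (2 * (p - 1) : ℝ) with he₁
  set K₃ : ℝ := Real.Gamma θ * ((2 * Real.pi) ^ (-θ) * (p : ℝ) ^ (a * θ)) with hK₃
  set err₁ : ℕ → ℝ := fun m ↦ C * ((4 * p : ℕ) *
    (q m ^ e₁ + (q m ^ (θ - 1) + K₃ * q m ^ (a * θ - 1)))) with herr₁
  set K₄ : ℝ := C * ((4 * p * p : ℕ) * (4 * (p : ℝ))) with hK₄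
  set K₅ : ℝ := Real.Gamma θ * (2 * Real.pi / Q) ^ (-θ) with hK₅
  set err₂ : ℕ → ℝ := fun m ↦ K₄ * (X m ^ (-(1 / 2 : ℝ)) + K₅ * X m ^ ((2 - a) * θ - 1 / 2))
    with herr₂
  -- limits
  have hXlim : Tendsto X atTop atTop := tendsto_pow_atTop_atTop_of_one_lt hpr
  have hqlim : Tendsto q atTop atTop :=
    (tendsto_pow_atTop_atTop_of_one_lt hpr).comp (tendsto_sub_atTop_nat 1)
  have hrpow : ∀ {Z : ℕ → ℝ} (_ : Tendsto Z atTop atTop) {e : ℝ} (_ : e < 0),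
      Tendsto (fun m ↦ Z m ^ e) atTop (𝓝 0) := by
    intro Z hZ e he
    have h := (tendsto_rpow_neg_atTop (neg_pos.mpr he)).comp hZ
    simp only [neg_neg] at h
    exact h
  have hp1r : (1 : ℝ) ≤ (p : ℝ) - 1 := by
    have : (2 : ℝ) ≤ p := by exact_mod_cast hp.out.two_le
    linarith
  have he₁neg : e₁ < 0 := div_neg_of_neg_of_pos (by linarith) (by positivity)
  have herr₁lim : Tendsto err₁ atTop (𝓝 0) := by
    have h := ((hrpow hqlim he₁neg).add ((hrpow hqlim (by linarith : θ - 1 < 0)).add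
      ((hrpow hqlim haθ).const_mul K₃))).const_mul ((4 * p : ℕ) : ℝ)
      |>.const_mul C
    simpa [herr₁] using h
  have herr₂lim : Tendsto err₂ atTop (𝓝 0) := by
    have h := ((hrpow hXlim (by norm_num : -(1 / 2 : ℝ) < 0)).add
      ((hrpow hXlim hdual).const_mul K₅)).const_mul K₄
    simpa [herr₂] using h
  have hexplim : Tendsto (fun m ↦ Real.exp (-(2 * Real.pi) * Y m)) atTop (𝓝 1) := by
    have hY0 : Tendsto Y atTop (𝓝 0) := hrpow hXlim (by linarith : -a < 0)
    have h0 : Tendsto (fun m ↦ -(2 * Real.pi) * Y m) atTop (𝓝 0) := by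
      simpa using hY0.const_mul (-(2 * Real.pi))
    have := (Real.continuous_exp.tendsto 0).comp h0
    rw [Real.exp_zero] at this
    refine this.congr fun m ↦ ?_
    simp only [Function.comp_apply]
  -- choose `m₀`
  have hev : ∀ᶠ m in atTop, err₁ m + err₂ m < 1 / 2 ∧ 1 / 2 < Real.exp (-(2 * Real.pi) * Y m) ∧
      3 ≤ m ∧ m₁ ≤ m := by
    refine ((herr₁lim.add herr₂lim).eventually (gt_mem_nhds ?_)).and
      ((hexplim.eventually (lt_mem_nhds ?_)).and ((eventually_ge_atTop 3).and
        (eventually_ge_atTop m₁)))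
    · norm_num
    · norm_num
  obtain ⟨m₀, hm₀⟩ := eventually_atTop.mp hev
  refine ⟨m₀, fun m hm ↦ ?_⟩
  obtain ⟨hlt, hexp, hm3, hmm₁⟩ := hm₀ m hm
  -- suppose all the twisted symbol sums vanish
  by_contra hall
  push Not at hall
  have hm0 : m ≠ 0 := by omega
  -- `N ∣ Q p^m`
  have hNm : N ∣ Q * p ^ m :=
    hNm₁.trans (mul_dvd_mul_left Q (pow_dvd_pow p hmm₁))
  obtain ⟨k, rfl⟩ : ∃ k, m = k + 3 := ⟨m - 3, by omega⟩
  set M := k + 3 with hM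
  have hcard : 0 < ((wildChars p M).card : ℝ) := by
    exact_mod_cast Finset.card_pos.mpr (wildChars_nonempty k)
  -- the moment vanishes
  have hmom : ∑ χ ∈ wildChars p M, gaussSum χ (ZMod.stdAddChar (N := p ^ M)) / (p ^ M : ℂ) *
      twistedSymbolSum f χ⁻¹ = 0 :=
    Finset.sum_eq_zero fun χ hχ ↦ by rw [hall χ⁻¹ (inv_mem_wildChars hχ), mul_zero]
  rw [sum_wildChars_twistedSymbolSum_eq_atkinLehner f hQN hc hε hε1 hpQ hNm (hYpos M)] at hmom
  -- the two error bounds at `Y = Y M`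
  have hE₁ := norm_dampedTwist_sum_wildChars_sub_le f (p := p) hm0 hC hθ hθ'1 ha h1 (hYpos M)
  have hY'pos : 0 < 1 / ((Q : ℝ) * (p ^ M : ℕ) ^ 2 * Y M) := by
    have : (0 : ℝ) < (p ^ M : ℕ) := Nat.cast_pos.mpr (pow_pos hp.out.pos _)
    have := hYpos M
    positivity
  have hE₂ := norm_dampedTwist_dual_le_of_not_dvd f (p := p) (Q := Q) hm0 hpQ hC hθ hθ'1 ha hY'pos
  -- simplify the error bounds to `#𝔛 · err₁ M` and `#𝔛 · err₂ M`
  have hqM : ((p ^ (M - 1) : ℕ) : ℝ) = q M := by simp [hqdef]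
  have hXM : ((p ^ M : ℕ) : ℝ) = X M := by simp [hXdef]
  have hA : (q M ^ (1 / (2 * (p - 1) : ℝ))) ^ (θ - 1) = q M ^ e₁ := by
    rw [← Real.rpow_mul (hqpos M).le, he₁]
    congr 1
    have : (2 * (p - 1) : ℝ) ≠ 0 := by positivity
    field_simp
  have hB : q M ^ (θ - 1) * (1 + Real.Gamma θ * (2 * Real.pi * Y M * q M) ^ (-θ)) =
      q M ^ (θ - 1) + K₃ * q M ^ (a * θ - 1) := by
    rw [hYdef]
    dsimp only
    rw [hXq M hm0, hK₃]
    have h := main_exponent_eq_offset (θ := θ) (a := a) hp0 (hqpos M)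
    linear_combination Real.Gamma θ * h
  have hE₁' : ‖dampedTwist f (fun n ↦ ∑ χ ∈ wildChars p M, χ n) (Y M) -
      (wildChars p M).card * (Real.exp (-(2 * Real.pi) * Y M) : ℝ)‖ ≤ (wildChars p M).card * err₁ M := by
    have h := hE₁
    rw [hqM, hA, hB] at h
    simpa only [herr₁] using h
  have hE₂' : ‖(ε / (p ^ M : ℂ)) * dampedTwist f (fun n ↦ ∑ χ ∈ wildChars p M,
      χ Q * gaussSum χ (ZMod.stdAddChar (N := p ^ M)) ^ 2 * χ⁻¹ n) (1 / ((Q : ℝ) * (p ^ M : ℕ) ^ 2 * Y M))‖ ≤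
      (wildChars p M).card * err₂ M := by
    rw [norm_mul, norm_div, hεn, show ‖(p ^ M : ℂ)‖ = X M by
      rw [show (p ^ M : ℂ) = ((p ^ M : ℕ) : ℂ) by push_cast; rfl, Complex.norm_natCast, hXM]]
    refine (mul_le_mul_of_nonneg_left hE₂ (by positivity)).trans ?_
    rw [hXM]
    have hZ : (2 * Real.pi * (1 / ((Q : ℝ) * X M ^ 2 * Y M))) ^ (-θ) =
        (2 * Real.pi / Q) ^ (-θ) * X M ^ ((2 - a) * θ) := by
      rw [hYdef]; exact dual_exponent_eq_offset hQr (hXpos M)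
    have hpk : (p : ℝ) ^ (M - M / 2) ≤ p * X M ^ (1 / 2 : ℝ) := pow_ceil_half_le_offset hpr.le M
    have hG : 0 ≤ Real.Gamma θ := (Real.Gamma_pos_of_pos hθ).le
    have hx1 : X M ^ (1 / 2 : ℝ) / X M = X M ^ (-(1 / 2 : ℝ)) := by
      rw [div_eq_iff (hXpos M).ne', ← Real.rpow_add_one (hXpos M).ne']
      norm_num
    have hx2 : X M ^ (1 / 2 : ℝ) * X M ^ ((2 - a) * θ) / X M = X M ^ ((2 - a) * θ - 1 / 2) := by
      rw [div_eq_iff (hXpos M).ne', ← Real.rpow_add (hXpos M), ← Real.rpow_add_one (hXpos M).ne']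
      congr 1; ring
    rw [hZ]
    calc 1 / X M * ((wildChars p M).card * (C * (((4 * p * p : ℕ) * (4 * (p : ℝ) ^ (M - M / 2))) *
          (1 + Real.Gamma θ * ((2 * Real.pi / Q) ^ (-θ) * X M ^ ((2 - a) * θ))))))
        ≤ 1 / X M * ((wildChars p M).card * (C * (((4 * p * p : ℕ) * (4 * ((p : ℝ) * X M ^ (1 / 2 : ℝ)))) *
          (1 + Real.Gamma θ * ((2 * Real.pi / Q) ^ (-θ) * X M ^ ((2 - a) * θ)))))) := by
          gcongr
      _ = (wildChars p M).card * (C * ((4 * p * p : ℕ) * (4 * (p : ℝ)))) *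
          (X M ^ (1 / 2 : ℝ) / X M + Real.Gamma θ * (2 * Real.pi / Q) ^ (-θ) *
            (X M ^ (1 / 2 : ℝ) * X M ^ ((2 - a) * θ) / X M)) := by
          ring
      _ = (wildChars p M).card * err₂ M := by
          rw [hx1, hx2]
          simp only [herr₂, hK₄, hK₅]
          ring
  -- the contradiction
  have hkey : ((wildChars p M).card : ℝ) * Real.exp (-(2 * Real.pi) * Y M) ≤
      (wildChars p M).card * err₁ M + (wildChars p M).card * err₂ M := by
    have hnorm : ‖((wildChars p M).card * (Real.exp (-(2 * Real.pi) * Y M) : ℝ) : ℂ)‖ =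
        ((wildChars p M).card : ℝ) * Real.exp (-(2 * Real.pi) * Y M) := by
      rw [show ((wildChars p M).card * (Real.exp (-(2 * Real.pi) * Y M) : ℝ) : ℂ) =
        (((wildChars p M).card * Real.exp (-(2 * Real.pi) * Y M) : ℝ) : ℂ) by push_cast; ring,
        Complex.norm_real, Real.norm_of_nonneg (by positivity)]
    rw [← hnorm]
    set D₁ := dampedTwist f (fun n ↦ ∑ χ ∈ wildChars p M, χ n) (Y M)
    set D₂ := (ε / (p ^ M : ℂ)) * dampedTwist f (fun n ↦ ∑ χ ∈ wildChars p M,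
      χ Q * gaussSum χ (ZMod.stdAddChar (N := p ^ M)) ^ 2 * χ⁻¹ n) (1 / ((Q : ℝ) * (p ^ M : ℕ) ^ 2 * Y M))
    have hD : D₁ = D₂ := sub_eq_zero.mp hmom
    calc ‖((wildChars p M).card * (Real.exp (-(2 * Real.pi) * Y M) : ℝ) : ℂ)‖
        = ‖(((wildChars p M).card * (Real.exp (-(2 * Real.pi) * Y M) : ℝ) : ℂ) - D₁) + D₂‖ := by
          rw [hD, sub_add_cancel]
      _ ≤ ‖((wildChars p M).card * (Real.exp (-(2 * Real.pi) * Y M) : ℝ) : ℂ) - D₁‖ + ‖D₂‖ :=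
          norm_add_le _ _
      _ ≤ _ := by
          refine add_le_add ?_ hE₂'
          rw [norm_sub_rev]; exact hE₁'
  have : Real.exp (-(2 * Real.pi) * Y M) ≤ err₁ M + err₂ M := by
    have h := hkey
    rw [← mul_add] at h
    exact le_of_mul_le_mul_left h hcard
  linarith

end Final

/-! ### The newform of an elliptic curve, at any prime -/

section EllipticCurve

variable {N : ℕ} [NeZero N] {f : CuspForm (Gamma0 N) 2} {p : ℕ} [hp : Fact p.Prime]
  {W : WeierstrassCurve ℚ} [W.IsElliptic]

omit [NeZero N] in
/-- The prime-to-`p` part `Q = N / p^{v_p(N)}` of `N ≥ 1` is an exact divisor of `N` coprime to `p`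
with `N ∣ Q · p^{v_p(N)}` (indeed `=`). [folklore] -/
theorem ordCompl_exactDivisor (hN : N ≠ 0) :
    ordCompl[p] N ∣ N ∧ Nat.Coprime (ordCompl[p] N) (N / ordCompl[p] N) ∧ ¬ p ∣ ordCompl[p] N ∧
      N ∣ ordCompl[p] N * p ^ (N.factorization p) := by
  have hcop : Nat.Coprime p (ordCompl[p] N) := Nat.coprime_ordCompl hp.out hN
  have hmul : ordProj[p] N * ordCompl[p] N = N := Nat.ordProj_mul_ordCompl_eq_self N p
  have hdiv : N / ordCompl[p] N = ordProj[p] N := by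
    rw [Nat.div_eq_iff_eq_mul_left (Nat.ordCompl_pos p hN) (Nat.ordCompl_dvd N p)]
    exact hmul.symm
  refine ⟨Nat.ordCompl_dvd N p, ?_, ?_, ?_⟩
  · rw [hdiv]
    exact (Nat.Coprime.pow_left _ hcop).symm
  · intro h
    exact hp.out.one_lt.ne' (Nat.Coprime.eq_one_of_dvd hcop h)
  · rw [mul_comm, hmul]

/-- **Non-vanishing twists of `p`-power conductor for the newform of an elliptic curve, at ANY
prime `p`.** Let `E = W/ℚ` be an elliptic curve and `f ∈ S₂(Γ₀(N))` its newform (`IsNewformOf W f`).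
For every prime `p` — dividing `N` or not — and all large `m`, some wild character `χ` of conductor
`p^m` (primitive, even, of `p`-power order) has `∑_a χ(a){∞, a/p^m}_f ≠ 0` (so `L(E, χ̄, 1) ≠ 0` by
Birch's formula): `exists_wildChars_twistedSymbolSum_ne_zero_atkinLehner` at the prime-to-`p` part
`Q = N/p^{v_p(N)}` (`ordCompl_exactDivisor`), where the newform is a `w_Q`-eigenvector with `ε = ±1`
(`IsNewform0.exists_atkinLehnerInvolution_eq_smul`, Knapp 1993 Thm. 9.27(b)), with `a₁ = 1` and the
Ramanujan–Hasse bound `|aₙ(E)| ≤ 16²⁵⁶ n^{5/8}` (`WeierstrassCurve.norm_LFunction_le_rpow`). For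
`p ∤ N` this is the input of the tree's `padicLFunction_ne_zero_of_isZLattice`; for `p ∣ N` it
replaces Rohrlich's 1989 theorem. [cite: RohrlichInventiones1984, Theorem 1] -/
theorem exists_wildChars_twistedSymbolSum_ne_zero_of_isNewformOf (hf : IsNewformOf W f) :
    ∃ m₀ : ℕ, ∀ m : ℕ, m₀ ≤ m → ∃ χ ∈ wildChars p m, twistedSymbolSum f χ ≠ 0 := by
  obtain ⟨hQN, hc, hpQ, hNm⟩ := ordCompl_exactDivisor (p := p) (NeZero.ne N)
  haveI : NeZero (ordCompl[p] N) := ⟨(Nat.ordCompl_pos p (NeZero.ne N)).ne'⟩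
  obtain ⟨ε, hε1, hε⟩ := hf.1.exists_atkinLehnerInvolution_eq_smul hQN hc
  have hε2 : ε ^ 2 = 1 := by
    rcases hε1 with rfl | rfl <;> norm_num
  have h1 : cuspCoeff f 1 = 1 := (isNormalized_iff_cuspCoeff_one f).mp hf.1.2.2
  have ha : ∀ n : ℕ, ‖cuspCoeff f n‖ ≤ (16 : ℝ) ^ 256 * (n : ℝ) ^ (5 / 8 : ℝ) := fun n ↦ by
    rw [hf.2 n]; exact W.norm_LFunction_le_rpow n
  exact exists_wildChars_twistedSymbolSum_ne_zero_atkinLehner f hQN hc hε hε2 hpQ hNm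
    (by positivity) (by norm_num) (by norm_num) ha h1

end EllipticCurve

end Summit.BirchSwinnertonDyer.BirchSwinnertonDyer.Theorems.PSNonvanishingAtLevel

end
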